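import Literature.NumberTheory.EllipticCurves.SelmerCorankPrimeDegreeGalois
import Literature.NumberTheory.EllipticCurves.BSDSelmerParityDokchitserProp417Proofs
import Literature.NumberTheory.EllipticCurves.BSDSelmerParityDokchitserTowerProofs
import Mathlib.GroupTheory.SpecificGroups.Dihedral
import HarnessLib

/-!
# Step (4) of Dokchitser–Dokchitser's Thm. 4.19 from Prop. 4.17 for a general dihedral extension

Proofs-only companion (theorems, no definitions, no named facts; D-0026) of
`BSDSelmerParityDokchitserProofs` for the named fact
`Literature.NumberTheory.EllipticCurves.dokchitser_selmerCorank_baseChange_mod_two_eq`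
("`rk_p(E/M₀)` is odd": T. Dokchitser, V. Dokchitser, *On the Birch–Swinnerton-Dyer quotients
modulo squares*, Ann. of Math. 172 (2010), §4.6, step (4) of the proof of Thm. 4.19 = Thm. 1.4).

The earlier reductions (`…Prop417Proofs`, `SelmerCorankPrimeDegreeGalois`) take the dihedral
congruence of Prop. 4.17 *specialised to the anticyclotomic tower* (`h417C`, `h417`: a statement
about `E/ℚ`, an imaginary quadratic `M₀` and the layers `M_n`). This file performs the remaining
piece of Galois theory printed on pp. 26–27 (arXiv numbering; Annals pp. 592–593),

> "Embedding `M_{n+1}` in `ℂ`, complex conjugation acts on the cyclic group `Gal(M_{n+1}/M₀)` as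
> `-1`, so `Gal(M_{n+1}/ℚ)` is dihedral. Write `F = M_{n+1}`, `M = M_n`, `L = M_{n+1} ∩ ℝ`,
> `K = M_n ∩ ℝ`. Then `H = Gal(F/K) ≅ D_{2p}`."

(`ZpExtension.isGalois_rat_layer`: `M_n/ℚ` is Galois; `ZpExtension.exists_rotation_layer_succ`: the
rotation `g` of order `p`, the restriction of `γ^{pⁿ}` for a topological generator `γ`, with
`g c g = c` for the complex conjugation `c = layerInvolution` of
`ModifiedTamagawaProductAnticyclotomicSquares`; `ZpExtension.exists_realSubfield_dihedral`: the real
subfield `K_n = M_n^{c} ⊆ M_n`, `[M_n : K_n] = 2`, over which `M_{n+1}` is Galois with group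
`D_{2p}`), and thereby derives the target from **Prop. 4.17 at its printed generality** — an
arbitrary number field `K`, an arbitrary Galois extension `F/K` with group `D_{2p}`, its quadratic
subextension `M/K`, and an elliptic curve `E/K` (the source allows a principally polarised abelian
variety `A/K`) — in the form in which it is invoked on p. 27:

> "Now we invoke Proposition 4.17: `rk_p(E/M) + m_ρ ≡ ord_p C(E/F)/C(E/M) (mod 2)`."

Here `m_ρ` is the multiplicity of the `(p-1)`-dimensional irreducible `ρ` of `D_{2p}` in
`X = X_p(E/F) ≅ 1^{m_1} ⊕ ε^{m_ε} ⊕ ρ^{m_ρ}`; since "`rk_p(E/M) = m_1 + m_ε`" (Lemma 4.14, p. 27)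
and `dim X = rk_p(E/F)`, it is characterised by `rk_p(E/F) = rk_p(E/M) + (p - 1) m_ρ` (such an
`m_ρ` exists by the tree theorem `exists_selmerCorank_baseChange_eq_add_of_prime_degree`,
Lemma 4.14 + Cor. 4.15 for `Gal(F/M) ≅ C_p`, file `SelmerCorankPrimeDegreeGalois`), which is how
the hypothesis `h417D` below phrases it; Prop. 4.17 itself writes the same number as
`2/(p-1) (rk_p(A/L) − rk_p(A/K))` ("`rk_p(E/K) = m_1`, `rk_p(E/L) = m_1 + (p-1)/2 m_ρ`", p. 27;
that identification — Lemma 4.14 for the non-normal subgroup `Gal(F/L)` — is the only part of the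
printed bookkeeping not performed here).

Main results:

* `ZpExtension.isGalois_rat_layer` — `M_n/ℚ` is Galois, for an anticyclotomic `ℤ_p`-extension of an
  imaginary quadratic field (counting automorphisms);
* `ZpExtension.exists_rotation_layer_succ`, `ZpExtension.exists_dihedral_generators`,
  `nonempty_mulEquiv_dihedralGroup` (a group of order `2p` with a rotation and a reflection is
  `D_{2p}`), `ZpExtension.exists_realSubfield_dihedral` — "`H = Gal(F/K) ≅ D_{2p}`" for
  `F = M_{n+1}`, `K = K_n = M_n ∩ ℝ`;
* `exists_even_selmerCorank_layer_of_prop417_dihedral` — from `h417D`, for `E/ℚ`, `p` odd, `M₀`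
  imaginary quadratic with the Heegner hypothesis for `N_E` and `κ` anticyclotomic: for every `n`
  some `m_ρ` has `rk_p(E/M_{n+1}) = rk_p(E/M_n) + (p-1) m_ρ` and `rk_p(E/M_n) + m_ρ` even — i.e.
  the hypothesis `h417` of `dokchitser_selmerCorank_baseChange_mod_two_eq_of_h417_of_hCV`
  (`SelmerCorankPrimeDegreeGalois`); the curve is first replaced by a global minimal model, for
  which `C(E/M_{n+1})`, `C(E/M_n)` are squares
  (`ZpExtension.isSquare_modifiedTamagawaProduct_baseChange_rat_layer`, "Since all bad primes of
  `E` split in `M/K` … both `C(E/F)` and `C(E/M)` are squares");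
* `dokchitser_selmerCorank_baseChange_mod_two_eq_of_prop417_dihedral_of_hCV` — the named fact from
  `h417D` and the Cornut–Vatsal / Nekovář input `hCV` ("`m_ρ = pⁿ` for `n` large", in the
  field-level form of `SelmerCorankPrimeDegreeGalois`).

What remains hypothetical is thus: Prop. 4.17 of the source (for elliptic curves), whose printed
proof is the isogeny-invariance / regulator-constant machinery of §§4.1–4.3 (Thm. 4.3 after
Tate–Milne, Cor. 4.5 with the Cassels–Tate pairing, Thm. 4.11) applied to products of Weil
restrictions, and the CM-point input of Cornut–Vatsal with Tian–Zhang / Nekovář; neither theory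
is in the tree. Everything in this file is proved.

## References

* [DokchitserDokchitserAnnals2010] T. Dokchitser, V. Dokchitser, *On the Birch–Swinnerton-Dyer
  quotients modulo squares*, Ann. of Math. 172 (2010), 567–596 = arXiv:math/0610290: Lemma 4.14,
  Prop. 4.17, §4.6 proof of Thm. 4.19 (arXiv pp. 24–27: Lemma 47, Prop. 50, Thm. 52).
* [CornutVatsal2007] C. Cornut, V. Vatsal, *Nontriviality of Rankin–Selberg L-functions and CM
  points*, in *L-functions and Galois representations* (Durham 2004), CUP 2007, Thm. 1.5, Thm. 4.2.
* [Nekovar2007] J. Nekovář, *The Euler system method for CM points on Shimura curves*, ibid.,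
  Thm. 3.2.
* [Greenberg1987] R. Greenberg, *Iwasawa theory for `p`-adic representations* (1987), §2
  (anticyclotomic: complex conjugation acts by `-1`).
-/

noncomputable section

open scoped Classical

open WeierstrassCurve NumberField Field IntermediateField

namespace Literature.NumberTheory.EllipticCurves

/-! ### The dihedral group `Gal(M_{n+1}/K_n) ≅ D_{2p}` -/

namespace ZpExtension

open GaloisRepresentations

variable {K : Type} [Field K] [NumberField K] {p : ℕ} [Fact p.Prime] {κ : ZpExtension K p}

/-- Conjugation by the transported involution: if `res τ' = c₀⁻¹ (res τ) c₀` in `Γ_ℚ` then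
`τ • (c y) = c (τ' • y)` on `K̄`, `c = e c₀ e⁻¹` (`absGaloisTransport`). Greenberg (1987), §2.
[folklore] -/
theorem smul_absGaloisTransport_eq_of_conj {c₀ : absoluteGaloisGroup ℚ}
    {τ τ' : absoluteGaloisGroup K}
    (h : absGaloisRestrict ℚ K τ' = c₀⁻¹ * absGaloisRestrict ℚ K τ * c₀) (y : AlgebraicClosure K) :
    τ • absGaloisTransport (K := ℚ) (L := K) c₀ y =
      absGaloisTransport (K := ℚ) (L := K) c₀ (τ' • y) := by
  rw [← absGaloisTransport_absGaloisRestrict (K := ℚ) τ' y, ← AlgEquiv.mul_apply, ← map_mul,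
    h, ← mul_assoc, ← mul_assoc, mul_inv_cancel, one_mul, map_mul, AlgEquiv.mul_apply,
    absGaloisTransport_absGaloisRestrict]

omit [NumberField K] in
/-- `γ^{pⁿ}` is not in `Gal(K̄/K_{n+1})`: `κ(γ^{pⁿ}) = pⁿ` is not divisible by `p^{n+1}` in `ℤ_p`.
Washington, §13.1. [folklore] -/
theorem pow_prime_pow_not_mem_layerSubgroup_succ {γ : absoluteGaloisGroup K}
    (hγ : κ.IsTopGenerator γ) (n : ℕ) : γ ^ p ^ n ∉ κ.layerSubgroup (n + 1) := by
  intro hmem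
  have hγ' : κ γ = Multiplicative.ofAdd 1 := hγ
  rw [ZpExtension.mem_layerSubgroup, map_pow, hγ', ← ofAdd_nsmul, toAdd_ofAdd, nsmul_eq_mul,
    mul_one, Nat.cast_pow] at hmem
  have hp : Prime (p : ℤ_[p]) := PadicInt.prime_p
  have h := (pow_dvd_pow_iff hp.ne_zero hp.not_unit).mp hmem
  omega

/-- **`M_n/ℚ` is Galois** for an anticyclotomic `ℤ_p`-extension of an imaginary quadratic field
(Dokchitser–Dokchitser 2010, §4.6, p. 26: "`Gal(M_{n+1}/ℚ)` is dihedral"; Greenberg (1987), §2).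
Proof by counting automorphisms (`IsGalois.of_card_aut_eq_finrank`): the `pⁿ` automorphisms of
`Gal(M_n/K)` and their composites with the complex conjugation `c = layerInvolution` of `M_n` are
`2pⁿ = [M_n : ℚ]` distinct `ℚ`-automorphisms (`c σ ≠ σ'` since `c` moves `K`,
`exists_layerInvolution_algebraMap_ne`), and there are at most `[M_n : ℚ]` of them
(`card_algHom_le_finrank`). [cite: DokchitserDokchitserAnnals2010, §4.6, proof of Thm. 4.19 (arXiv p. 26)]
[cite: Greenberg1987, §2] -/
theorem isGalois_rat_layer (hK : IsImaginaryQuadratic K) (hκ : κ.IsAnticyclotomic) (m : ℕ) :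
    IsGalois ℚ (κ.layer m) := by
  haveI : IsTotallyComplex K := hK.2
  obtain ⟨c₀, hc₀, hc⟩ := exists_not_mem_range_absGaloisRestrict (K := ℚ) K (Rat.castHom ℝ)
    IsTotallyComplex.isComplex
  obtain ⟨x₀, hx₀⟩ := exists_layerInvolution_algebraMap_ne hK.1 hκ hc₀ hc m
  haveI : Module.Free K (κ.layer m) := Module.Free.of_divisionRing _ _
  -- `c σ ≠ σ'` for `K`-automorphisms `σ, σ'`
  have key : ∀ σ σ' : (κ.layer m) ≃ₐ[K] (κ.layer m),
      layerInvolution hK.1 hκ hc₀ hc m * σ.restrictScalars ℚ ≠ σ'.restrictScalars ℚ := by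
    intro σ σ' h
    apply hx₀
    have hce : layerInvolution hK.1 hκ hc₀ hc m =
        σ'.restrictScalars ℚ * (σ.restrictScalars ℚ)⁻¹ := by rw [← h, mul_inv_cancel_right]
    rw [hce, AlgEquiv.mul_apply, AlgEquiv.aut_inv]
    change σ' (σ.symm (algebraMap K (κ.layer m) x₀)) = algebraMap K (κ.layer m) x₀
    rw [σ.symm.commutes, σ'.commutes]
  -- the injection `Bool × Gal(M_m/K) → Aut(M_m/ℚ)`
  let Ψ : Bool × ((κ.layer m) ≃ₐ[K] (κ.layer m)) → ((κ.layer m) ≃ₐ[ℚ] (κ.layer m)) :=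
    fun bs ↦ (if bs.1 then layerInvolution hK.1 hκ hc₀ hc m else 1) * bs.2.restrictScalars ℚ
  have hΨ : Function.Injective Ψ := by
    rintro ⟨b, σ⟩ ⟨b', σ'⟩ h
    cases b <;> cases b'
    · simp only [Ψ, Bool.false_eq_true, ↓reduceIte, one_mul] at h
      rw [AlgEquiv.restrictScalars_injective ℚ h]
    · simp only [Ψ, Bool.false_eq_true, ↓reduceIte, one_mul] at h
      exact absurd h.symm (key σ' σ)
    · simp only [Ψ, Bool.false_eq_true, ↓reduceIte, one_mul] at h
      exact absurd h (key σ σ')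
    · simp only [Ψ, ↓reduceIte] at h
      rw [AlgEquiv.restrictScalars_injective ℚ (mul_left_cancel h)]
  have hfin : Module.finrank ℚ (κ.layer m) = 2 * p ^ m := by
    rw [← Module.finrank_mul_finrank ℚ K (κ.layer m), hK.1, κ.finrank_layer_holds m]
  have hge : 2 * p ^ m ≤ Nat.card ((κ.layer m) ≃ₐ[ℚ] (κ.layer m)) := by
    have h1 : Nat.card (Bool × ((κ.layer m) ≃ₐ[K] (κ.layer m))) = 2 * p ^ m := by
      rw [Nat.card_prod, Nat.card_eq_fintype_card (α := Bool), Fintype.card_bool,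
        IsGalois.card_aut_eq_finrank, κ.finrank_layer_holds m]
    rw [← h1]
    exact Nat.card_le_card_of_injective Ψ hΨ
  have hle : Nat.card ((κ.layer m) ≃ₐ[ℚ] (κ.layer m)) ≤ Module.finrank ℚ (κ.layer m) :=
    (Nat.card_le_card_of_injective _ AlgEquiv.coe_toAlgHom_injective).trans
      (card_algHom_le_finrank ℚ (κ.layer m) (κ.layer m))
  exact IsGalois.of_card_aut_eq_finrank _ _ (le_antisymm hle (hfin ▸ hge))

/-- **The rotation of `Gal(M_{n+1}/K_n) ≅ D_{2p}`** (Dokchitser–Dokchitser 2010, §4.6, proof of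
Thm. 4.19, p. 26: "complex conjugation acts on the cyclic group `Gal(M_{n+1}/M₀)` as `-1`, so
`Gal(M_{n+1}/ℚ)` is dihedral … `H = Gal(F/K) ≅ D_{2p}`"). For `[K : ℚ] = 2`, an anticyclotomic
`ℤ_p`-extension `κ` of `K`, the complex conjugation `c = layerInvolution … (n + 1)` of
`F = M_{n+1}` and any `n`: there is a `ℚ`-automorphism `g` of `M_{n+1}` of order `p` (`gᵖ = 1`,
`g ≠ 1`) fixing `M_n` pointwise with `g c g = c`. It is the restriction of `γ^{pⁿ}` (`γ` a
topological generator): `(γ^{pⁿ})ᵖ ∈ Gal(K̄/M_{n+1})`, `γ^{pⁿ} ∉ Gal(K̄/M_{n+1})`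
(`fixingSubgroup_layer`, `pow_prime_pow_not_mem_layerSubgroup_succ`), `γ^{pⁿ} ∈ Gal(K̄/M_n)`; and
`g c g = c` because the `c₀`-conjugate `τ'` of `τ = γ^{pⁿ}` has `κ τ' = (κ τ)⁻¹`
(`apply_eq_inv_of_absGaloisRestrict_eq_conj`), so `τ • c (τ • x) = c (τ' τ • x) = c x`.
[cite: DokchitserDokchitserAnnals2010, §4.6, proof of Thm. 4.19 (arXiv p. 26)] [cite: Greenberg1987, §2] -/
theorem exists_rotation_layer_succ (hK : Module.finrank ℚ K = 2) (hκ : κ.IsAnticyclotomic)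
    {c₀ : absoluteGaloisGroup ℚ} (hc₀ : c₀ ∉ Set.range (absGaloisRestrict ℚ K)) (hc : c₀ * c₀ = 1)
    (n : ℕ) :
    ∃ g : (κ.layer (n + 1)) ≃ₐ[ℚ] (κ.layer (n + 1)),
      g ^ p = 1 ∧ g ≠ 1 ∧
        g * layerInvolution hK hκ hc₀ hc (n + 1) * g = layerInvolution hK hκ hc₀ hc (n + 1) ∧
          ∀ x : κ.layer (n + 1), (x : AlgebraicClosure K) ∈ κ.layer n → g x = x := by
  obtain ⟨γ, hγ⟩ := κ.exists_isTopGenerator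
  have hτ₀n : γ ^ p ^ n ∈ κ.layerSubgroup n := κ.pow_mem_layerSubgroup hγ n
  have hτ₀p : (γ ^ p ^ n) ^ p ∈ κ.layerSubgroup (n + 1) := by
    rw [← pow_mul, ← pow_succ]
    exact κ.pow_mem_layerSubgroup hγ (n + 1)
  let g₀ : (κ.layer (n + 1)) ≃ₐ[K] (κ.layer (n + 1)) :=
    AlgEquiv.restrictNormal (absoluteGaloisGroup.toAlgEquiv K (γ ^ p ^ n)) (κ.layer (n + 1))
  let g : (κ.layer (n + 1)) ≃ₐ[ℚ] (κ.layer (n + 1)) := g₀.restrictScalars ℚ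
  have hg_coe : ∀ x : κ.layer (n + 1),
      ((g x : κ.layer (n + 1)) : AlgebraicClosure K) = (γ ^ p ^ n) • (x : AlgebraicClosure K) :=
    fun x ↦ AlgEquiv.restrictNormal_apply (κ.layer (n + 1)) _ x
  have hgk_coe : ∀ (k : ℕ) (x : κ.layer (n + 1)),
      (((g ^ k) x : κ.layer (n + 1)) : AlgebraicClosure K) =
        ((γ ^ p ^ n) ^ k) • (x : AlgebraicClosure K) := by
    intro k
    induction k with
    | zero => intro x; rw [pow_zero, pow_zero, AlgEquiv.one_apply, one_smul]
    | succ k ih => intro x; rw [pow_succ, AlgEquiv.mul_apply, ih, hg_coe, ← mul_smul, ← pow_succ]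
  refine ⟨g, ?_, ?_, ?_, fun x hx ↦ ?_⟩
  · -- `gᵖ = 1`
    refine AlgEquiv.ext fun x ↦ Subtype.ext ?_
    rw [hgk_coe, AlgEquiv.one_apply]
    exact (mem_layer_iff κ (n + 1) _).mp x.2 _ hτ₀p
  · -- `g ≠ 1`
    intro h1
    apply pow_prime_pow_not_mem_layerSubgroup_succ hγ n
    have hfix : absoluteGaloisGroup.toAlgEquiv K (γ ^ p ^ n) ∈ (κ.layer (n + 1)).fixingSubgroup := by
      rw [IntermediateField.mem_fixingSubgroup_iff]
      intro x hx
      have h := hg_coe ⟨x, hx⟩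
      rw [h1, AlgEquiv.one_apply, absoluteGaloisGroup.smul_def] at h
      exact h.symm
    rw [κ.fixingSubgroup_layer (n + 1)] at hfix
    obtain ⟨σ, hσ, hσeq⟩ := Subgroup.mem_map.mp hfix
    have hστ : σ = γ ^ p ^ n := (absoluteGaloisGroup.toAlgEquiv K).injective hσeq
    rwa [hστ] at hσ
  · -- `g c g = c` (anticyclotomy)
    obtain ⟨τ', hτ'⟩ := exists_absGaloisRestrict_eq_conj hK hc₀ (γ ^ p ^ n)
    have hinv : κ τ' = (κ (γ ^ p ^ n))⁻¹ := apply_eq_inv_of_absGaloisRestrict_eq_conj hκ hc₀ hτ'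
    have hker : τ' * γ ^ p ^ n ∈ κ.layerSubgroup (n + 1) :=
      κ.kerSubgroup_le_layerSubgroup (n + 1)
        (by rw [ZpExtension.mem_kerSubgroup, map_mul, hinv, inv_mul_cancel])
    refine AlgEquiv.ext fun x ↦ Subtype.ext ?_
    change (((g (layerInvolution hK hκ hc₀ hc (n + 1) (g x))) : κ.layer (n + 1)) :
        AlgebraicClosure K) =
      ((layerInvolution hK hκ hc₀ hc (n + 1) x : κ.layer (n + 1)) : AlgebraicClosure K)
    rw [hg_coe, coe_layerInvolution_apply, hg_coe, smul_absGaloisTransport_eq_of_conj hτ',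
      ← mul_smul, (mem_layer_iff κ (n + 1) _).mp x.2 _ hker, coe_layerInvolution_apply]
  · -- `g` fixes `M_n`
    apply Subtype.ext
    rw [hg_coe]
    exact (mem_layer_iff κ n _).mp hx _ hτ₀n

end ZpExtension

/-! ### A group of order `2p` with a rotation and a reflection is `D_{2p}` -/

/-- **Recognition of the dihedral group.** A group `G` of order `2p` (`p` prime) containing `g`
with `gᵖ = 1`, `g ≠ 1` and `c` with `c² = 1`, `g c g = c` and `c gᵏ ≠ 1` for all `k` is isomorphic
to `D_{2p}`: `rᵢ ↦ gⁱ`, `s rᵢ ↦ c gⁱ` is an injective homomorphism `D_{2p} → G` between groups of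
the same order. (Used for `G = Gal(M_{n+1}/K_n)`, Dokchitser–Dokchitser 2010, §4.6:
"`H = Gal(F/K) ≅ D_{2p}`".) [folklore] -/
theorem nonempty_mulEquiv_dihedralGroup {G : Type*} [Group G] [Finite G] {p : ℕ} [Fact p.Prime]
    (hG : Nat.card G = 2 * p) {g c : G} (hgp : g ^ p = 1) (hg1 : g ≠ 1) (hcc : c * c = 1)
    (hgcg : g * c * g = c) (hcg : ∀ k : ℕ, c * g ^ k ≠ 1) : Nonempty (G ≃* DihedralGroup p) := by
  haveI : NeZero p := ⟨(Fact.out : p.Prime).ne_zero⟩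
  have horder : orderOf g = p := orderOf_eq_prime hgp hg1
  have hgc : g * c = c * g⁻¹ := by
    calc g * c = g * c * g * g⁻¹ := by group
      _ = c * g⁻¹ := by rw [hgcg]
  have hgkc : ∀ k : ℕ, g ^ k * c = c * (g ^ k)⁻¹ := by
    intro k
    induction k with
    | zero => rw [pow_zero, one_mul, inv_one, mul_one]
    | succ k ih =>
      calc g ^ (k + 1) * c = g ^ k * (g * c) := by rw [pow_succ, mul_assoc]
        _ = g ^ k * c * g⁻¹ := by rw [hgc, mul_assoc]
        _ = c * ((g ^ k)⁻¹ * g⁻¹) := by rw [ih, mul_assoc]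
        _ = c * (g ^ (k + 1))⁻¹ := by rw [← mul_inv_rev, ← pow_succ']
  -- powers of `g` indexed by `ZMod p`
  have hmod : ∀ a : ℕ, g ^ (a % p) = g ^ a := fun a ↦ by
    conv_rhs => rw [← Nat.mod_add_div a p, pow_add, pow_mul, hgp, one_pow, mul_one]
  have hψadd : ∀ i j : ZMod p, g ^ (i + j).val = g ^ i.val * g ^ j.val := fun i j ↦ by
    rw [ZMod.val_add, hmod, pow_add]
  have hψneg : ∀ i : ZMod p, g ^ (-i).val = (g ^ i.val)⁻¹ := fun i ↦ by
    apply eq_inv_of_mul_eq_one_left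
    rw [← hψadd, neg_add_cancel, ZMod.val_zero, pow_zero]
  -- the homomorphism `D_{2p} → G`
  let φf : DihedralGroup p → G
    | DihedralGroup.r i => g ^ i.val
    | DihedralGroup.sr i => c * g ^ i.val
  have hφf_r : ∀ i, φf (DihedralGroup.r i) = g ^ i.val := fun _ ↦ rfl
  have hφf_sr : ∀ i, φf (DihedralGroup.sr i) = c * g ^ i.val := fun _ ↦ rfl
  have hφmul : ∀ a b, φf (a * b) = φf a * φf b := by
    rintro (i | i) (j | j)
    · rw [DihedralGroup.r_mul_r, hφf_r, hφf_r, hφf_r, hψadd]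
    · rw [DihedralGroup.r_mul_sr, hφf_sr, hφf_r, hφf_sr, ← mul_assoc, hgkc, ← hψneg, mul_assoc,
        ← hψadd, neg_add_eq_sub]
    · rw [DihedralGroup.sr_mul_r, hφf_sr, hφf_sr, hφf_r, hψadd, mul_assoc]
    · rw [DihedralGroup.sr_mul_sr, hφf_sr, hφf_sr, hφf_r,
        show c * g ^ i.val * (c * g ^ j.val) = c * (g ^ i.val * c) * g ^ j.val by
          simp only [mul_assoc],
        hgkc, ← mul_assoc, hcc, one_mul, ← hψneg, ← hψadd, neg_add_eq_sub]
  let φ : DihedralGroup p →* G := MonoidHom.mk' φf hφmul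
  have hφ_r : ∀ i, φ (DihedralGroup.r i) = g ^ i.val := fun _ ↦ rfl
  have hφ_sr : ∀ i, φ (DihedralGroup.sr i) = c * g ^ i.val := fun _ ↦ rfl
  have hφinj : Function.Injective φ := by
    rw [injective_iff_map_eq_one]
    rintro (i | i) hi
    · rw [hφ_r] at hi
      have hdvd : p ∣ i.val := by
        have h := orderOf_dvd_iff_pow_eq_one.mpr hi
        rwa [horder] at h
      have hi0 : i.val = 0 := Nat.eq_zero_of_dvd_of_lt hdvd (ZMod.val_lt i)
      rw [ZMod.val_eq_zero] at hi0
      rw [hi0, DihedralGroup.r_zero]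
    · rw [hφ_sr] at hi
      exact absurd hi (hcg i.val)
  have hcard : Nat.card (DihedralGroup p) = Nat.card G := by rw [DihedralGroup.nat_card, hG]
  exact ⟨(MulEquiv.ofBijective φ ((Nat.bijective_iff_injective_and_card φ).mpr ⟨hφinj, hcard⟩)).symm⟩

/-- **`Aut(F/R) ≅ D_{2p}` from `ℚ`-automorphisms fixing `R`.** For an `R`-algebra `F` (a field)
with `#Aut(F/R) = 2p` and `ℚ`-automorphisms `g`, `c` of `F` fixing the image of `R`, with
`gᵖ = 1 ≠ g`, `c² = 1`, `g c g = c` and `c gᵏ y₀ ≠ y₀` for some `y₀` and all `k`: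
`Aut(F/R) ≅ D_{2p}` (`nonempty_mulEquiv_dihedralGroup` applied to the `R`-linear maps underlying
`g`, `c`, `AlgEquiv.ofRingEquiv`). [folklore] -/
theorem nonempty_mulEquiv_dihedralGroup_gal {p : ℕ} [Fact p.Prime] {R F : Type*} [CommRing R]
    [Field F] [Algebra ℚ F] [Algebra R F] (hcard : Nat.card (F ≃ₐ[R] F) = 2 * p)
    {g c : F ≃ₐ[ℚ] F}
    (hgR : ∀ r : R, g.toRingEquiv (algebraMap R F r) = algebraMap R F r)
    (hcR : ∀ r : R, c.toRingEquiv (algebraMap R F r) = algebraMap R F r)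
    (hgp : g ^ p = 1) (hg1 : g ≠ 1) (hcc : c * c = 1) (hgcg : g * c * g = c)
    {y₀ : F} (hy₀ : ∀ k : ℕ, (c * g ^ k) y₀ ≠ y₀) :
    Nonempty ((F ≃ₐ[R] F) ≃* DihedralGroup p) := by
  set gR : F ≃ₐ[R] F := AlgEquiv.ofRingEquiv hgR with hgRdef
  set cR : F ≃ₐ[R] F := AlgEquiv.ofRingEquiv hcR with hcRdef
  have hgRx : ∀ x, gR x = g x := fun _ ↦ rfl
  have hcRx : ∀ x, cR x = c x := fun _ ↦ rfl
  have hgRk : ∀ (k : ℕ) (x : F), (gR ^ k) x = (g ^ k) x := by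
    intro k
    induction k with
    | zero => intro x; rw [pow_zero, pow_zero, AlgEquiv.one_apply, AlgEquiv.one_apply]
    | succ k ih => intro x; rw [pow_succ, pow_succ, AlgEquiv.mul_apply, AlgEquiv.mul_apply, hgRx, ih]
  haveI : Finite (F ≃ₐ[R] F) := Nat.finite_of_card_ne_zero (by
    rw [hcard]; exact Nat.mul_ne_zero two_ne_zero (Fact.out : p.Prime).ne_zero)
  refine nonempty_mulEquiv_dihedralGroup (g := gR) (c := cR) hcard ?_ ?_ ?_ ?_ ?_
  · refine AlgEquiv.ext fun x ↦ ?_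
    rw [hgRk, hgp, AlgEquiv.one_apply, AlgEquiv.one_apply]
  · intro h1
    apply hg1
    refine AlgEquiv.ext fun x ↦ ?_
    rw [← hgRx, h1, AlgEquiv.one_apply, AlgEquiv.one_apply]
  · refine AlgEquiv.ext fun x ↦ ?_
    rw [AlgEquiv.mul_apply, hcRx, hcRx, ← AlgEquiv.mul_apply, hcc, AlgEquiv.one_apply,
      AlgEquiv.one_apply]
  · refine AlgEquiv.ext fun x ↦ ?_
    rw [AlgEquiv.mul_apply, AlgEquiv.mul_apply, hgRx, hcRx, hgRx, ← AlgEquiv.mul_apply,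
      ← AlgEquiv.mul_apply, hgcg, hcRx]
  · intro k hk
    apply hy₀ k
    have h' := AlgEquiv.congr_fun hk y₀
    rw [AlgEquiv.mul_apply, hgRk, hcRx, AlgEquiv.one_apply, ← AlgEquiv.mul_apply] at h'
    exact h'

/-! ### The real subfield and its dihedral Galois group -/

namespace ZpExtension

open GaloisRepresentations

variable {K : Type} [Field K] [NumberField K] {p : ℕ} [Fact p.Prime] {κ : ZpExtension K p}

/-- **Generators of the dihedral group `Gal(M_{n+1}/K_n)`** (Dokchitser–Dokchitser 2010, §4.6,
proof of Thm. 4.19, p. 26). For an imaginary quadratic `K`, an anticyclotomic `ℤ_p`-extension `κ`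
and any `n` (with `M_{n+1}` an `M_n`-algebra through the inclusion, hypothesis `hincl`): the complex
conjugations `c_M`, `c_F` of `M = M_n`, `F = M_{n+1}` (`layerInvolution`: involutions, `c_M ≠ 1`,
`c_F` restricting to `c_M`) and the rotation `g` of `exists_rotation_layer_succ` (`gᵖ = 1 ≠ g`,
`g c_F g = c_F`, `g` trivial on `M_n`), together with a witness in `K` moved by every `c_F gᵏ`
(`gᵏ` fixes `K ⊆ M_n`, `c_F` moves `K`, `exists_layerInvolution_algebraMap_ne`).
[cite: DokchitserDokchitserAnnals2010, §4.6, proof of Thm. 4.19 (arXiv p. 26)] [cite: Greenberg1987, §2] -/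
theorem exists_dihedral_generators (hK : IsImaginaryQuadratic K) (hκ : κ.IsAnticyclotomic)
    (n : ℕ) [Algebra (κ.layer n) (κ.layer (n + 1))]
    (hincl : ∀ y : κ.layer n,
      ((algebraMap (κ.layer n) (κ.layer (n + 1)) y : κ.layer (n + 1)) : AlgebraicClosure K) = y) :
    ∃ (cM : (κ.layer n) ≃ₐ[ℚ] (κ.layer n)) (cF g : (κ.layer (n + 1)) ≃ₐ[ℚ] (κ.layer (n + 1))),
      cM * cM = 1 ∧ cM ≠ 1 ∧ cF * cF = 1 ∧ g ^ p = 1 ∧ g ≠ 1 ∧ g * cF * g = cF ∧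
        (∀ y : κ.layer n, cF (algebraMap (κ.layer n) (κ.layer (n + 1)) y) =
          algebraMap (κ.layer n) (κ.layer (n + 1)) (cM y)) ∧
        (∀ y : κ.layer n, g (algebraMap (κ.layer n) (κ.layer (n + 1)) y) =
          algebraMap (κ.layer n) (κ.layer (n + 1)) y) ∧
        ∃ x₀ : K, ∀ k : ℕ, (cF * g ^ k) (algebraMap K (κ.layer (n + 1)) x₀) ≠
          algebraMap K (κ.layer (n + 1)) x₀ := by
  haveI : IsTotallyComplex K := hK.2
  obtain ⟨c₀, hc₀, hc⟩ := exists_not_mem_range_absGaloisRestrict (K := ℚ) K (Rat.castHom ℝ)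
    IsTotallyComplex.isComplex
  obtain ⟨g, hgp, hg1, hgcg, hgfix⟩ := exists_rotation_layer_succ hK.1 hκ hc₀ hc n
  obtain ⟨x₀, hx₀⟩ := exists_layerInvolution_algebraMap_ne hK.1 hκ hc₀ hc (n + 1)
  -- `c_M ≠ 1`: it moves `K`
  have hcM1 : layerInvolution hK.1 hκ hc₀ hc n ≠ 1 := by
    obtain ⟨x, hx⟩ := exists_layerInvolution_algebraMap_ne hK.1 hκ hc₀ hc n
    intro h1
    rw [h1, AlgEquiv.one_apply] at hx
    exact hx rfl
  -- `c_F` restricts to `c_M`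
  have hcF_incl : ∀ y : κ.layer n,
      layerInvolution hK.1 hκ hc₀ hc (n + 1) (algebraMap (κ.layer n) (κ.layer (n + 1)) y) =
        algebraMap (κ.layer n) (κ.layer (n + 1)) (layerInvolution hK.1 hκ hc₀ hc n y) := by
    intro y
    apply Subtype.ext
    rw [coe_layerInvolution_apply, hincl, hincl, coe_layerInvolution_apply]
  -- `g` is trivial on `M_n`
  have hgM : ∀ y : κ.layer n, g (algebraMap (κ.layer n) (κ.layer (n + 1)) y) =
      algebraMap (κ.layer n) (κ.layer (n + 1)) y := fun y ↦ hgfix _ (by rw [hincl]; exact y.2)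
  -- `c_F gᵏ` moves `x₀`
  have hx₀mem : ((algebraMap K (κ.layer (n + 1)) x₀ : κ.layer (n + 1)) : AlgebraicClosure K) ∈
      κ.layer n := (κ.layer n).algebraMap_mem x₀
  have hgkx₀ : ∀ j : ℕ, (g ^ j) (algebraMap K (κ.layer (n + 1)) x₀) =
      algebraMap K (κ.layer (n + 1)) x₀ := by
    intro j
    induction j with
    | zero => rw [pow_zero, AlgEquiv.one_apply]
    | succ j ih => rw [pow_succ, AlgEquiv.mul_apply, hgfix _ hx₀mem, ih]
  have hmove : ∀ k : ℕ, (layerInvolution hK.1 hκ hc₀ hc (n + 1) * g ^ k)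
      (algebraMap K (κ.layer (n + 1)) x₀) ≠ algebraMap K (κ.layer (n + 1)) x₀ := fun k ↦ by
    rwa [AlgEquiv.mul_apply, hgkx₀]
  exact ⟨layerInvolution hK.1 hκ hc₀ hc n, layerInvolution hK.1 hκ hc₀ hc (n + 1), g,
    layerInvolution_mul_self hK.1 hκ hc₀ hc n, hcM1, layerInvolution_mul_self hK.1 hκ hc₀ hc (n + 1),
    hgp, hg1, hgcg, hcF_incl, hgM, x₀, hmove⟩

/-- **The real subfield `K_n = M_n ∩ ℝ` and `Gal(M_{n+1}/K_n) ≅ D_{2p}`** (Dokchitser–Dokchitser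
2010, §4.6, proof of Thm. 4.19, p. 26: "Write `F = M_{n+1}`, `M = M_n`, `L = M_{n+1} ∩ ℝ`,
`K = M_n ∩ ℝ`. Then `H = Gal(F/K) ≅ D_{2p}`"). For an imaginary quadratic `K`, an odd prime `p`, an
anticyclotomic `ℤ_p`-extension `κ` of `K` and any `n` (the layer `M_{n+1}` being an `M_n`-algebra
through the inclusion, hypothesis `hincl`): the fixed field `K_n ⊆ M_n` of the complex conjugation
`c_M` of `M_n` has `[M_n : K_n] = 2`, `M_{n+1}/K_n` is Galois (indeed `M_{n+1}/ℚ` is,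
`isGalois_rat_layer`) and `Gal(M_{n+1}/K_n) ≅ D_{2p}` — a group of order `[M_{n+1} : K_n] = 2p`
containing the `K_n`-linear rotation `g` and complex conjugation `c_F` of
`exists_dihedral_generators`, recognised by `nonempty_mulEquiv_dihedralGroup`.
[cite: DokchitserDokchitserAnnals2010, §4.6, proof of Thm. 4.19 (arXiv p. 26)] [cite: Greenberg1987, §2] -/
theorem exists_realSubfield_dihedral (hK : IsImaginaryQuadratic K) (hκ : κ.IsAnticyclotomic)
    (n : ℕ) [Algebra (κ.layer n) (κ.layer (n + 1))]
    (hincl : ∀ y : κ.layer n,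
      ((algebraMap (κ.layer n) (κ.layer (n + 1)) y : κ.layer (n + 1)) : AlgebraicClosure K) = y) :
    ∃ R : IntermediateField ℚ (κ.layer n),
      IsGalois R (κ.layer (n + 1)) ∧
        Nonempty (((κ.layer (n + 1)) ≃ₐ[R] (κ.layer (n + 1))) ≃* DihedralGroup p) ∧
          Module.finrank R (κ.layer n) = 2 := by
  have hprime : p.Prime := Fact.out
  -- `M_{n+1}/M_n` is Galois of degree `p`
  haveI htower : IsScalarTower K (κ.layer n) (κ.layer (n + 1)) := by
    refine IsScalarTower.of_algebraMap_eq fun x ↦ Subtype.ext ?_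
    rw [hincl, IntermediateField.coe_algebraMap_apply, IntermediateField.coe_algebraMap_apply]
  haveI : IsGalois (κ.layer n) (κ.layer (n + 1)) := IsGalois.tower_top_of_isGalois K _ _
  haveI : Module.Free (κ.layer n) (κ.layer (n + 1)) := Module.Free.of_divisionRing _ _
  have hdeg : Module.finrank (κ.layer n) (κ.layer (n + 1)) = p := by
    have h := Module.finrank_mul_finrank K (κ.layer n) (κ.layer (n + 1))
    rw [κ.finrank_layer_holds n, κ.finrank_layer_holds (n + 1), pow_succ] at h
    exact Nat.eq_of_mul_eq_mul_left (pow_pos hprime.pos n) h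
  clear htower
  -- the generators
  obtain ⟨cM, cF, g, hcMcM, hcM1, hcFcF, hgp, hg1, hgcg, hcF_incl, hgM, x₀, hx₀⟩ :=
    exists_dihedral_generators hK hκ n hincl
  -- the real subfield `R = K_n = M_n^{c_M}`
  obtain ⟨R, hRdef⟩ : ∃ R : IntermediateField ℚ (κ.layer n),
      R = IntermediateField.fixedField (Subgroup.zpowers cM) := ⟨_, rfl⟩
  have hdeg2' : Module.finrank R (κ.layer n) = 2 := by
    subst hRdef
    rw [IntermediateField.finrank_fixedField_eq_card, Nat.card_zpowers]
    exact orderOf_eq_prime (by rw [pow_two, hcMcM]) hcM1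
  have hRfix : ∀ r : R, cM (r : κ.layer n) = r := fun r ↦ by
    have hr : (r : κ.layer n) ∈ IntermediateField.fixedField (Subgroup.zpowers cM) := hRdef ▸ r.2
    exact (IntermediateField.mem_fixedField_iff (Subgroup.zpowers cM) (r : κ.layer n)).mp hr cM
      (Subgroup.mem_zpowers cM)
  -- pin the `R`-structures once (instance search through the coerced intermediate fields is slow)
  letI instRF : Algebra R (κ.layer (n + 1)) := inferInstance
  letI instModRF : Module R (κ.layer (n + 1)) := Algebra.toModule
  letI instModRM : Module R (κ.layer n) := Algebra.toModule
  haveI instTow : IsScalarTower R (κ.layer n) (κ.layer (n + 1)) := inferInstance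
  haveI : Module.Free R (κ.layer n) := Module.Free.of_divisionRing _ _
  haveI : Module.Free R (κ.layer (n + 1)) := Module.Free.of_divisionRing _ _
  haveI : IsGalois ℚ (κ.layer (n + 1)) := isGalois_rat_layer hK hκ (n + 1)
  haveI : IsGalois R (κ.layer (n + 1)) := IsGalois.tower_top_of_isGalois ℚ R _
  have hdeg2 : Module.finrank R (κ.layer n) = 2 := hdeg2'
  have hdegF : Module.finrank R (κ.layer (n + 1)) = 2 * p := by
    rw [← Module.finrank_mul_finrank R (κ.layer n) (κ.layer (n + 1)), hdeg2, hdeg]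
  haveI : FiniteDimensional R (κ.layer (n + 1)) :=
    Module.finite_of_finrank_pos (by rw [hdegF]; exact Nat.mul_pos two_pos hprime.pos)
  have hcard : Nat.card ((κ.layer (n + 1)) ≃ₐ[R] (κ.layer (n + 1))) = 2 * p := by
    rw [IsGalois.card_aut_eq_finrank, hdegF]
  -- `g` and `c_F` are `K_n`-linear
  have hgR : ∀ r : R, g.toRingEquiv (algebraMap R (κ.layer (n + 1)) r) =
      algebraMap R (κ.layer (n + 1)) r := fun r ↦ by
    rw [IsScalarTower.algebraMap_apply R (κ.layer n) (κ.layer (n + 1))]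
    exact hgM _
  have hcR : ∀ r : R, cF.toRingEquiv (algebraMap R (κ.layer (n + 1)) r) =
      algebraMap R (κ.layer (n + 1)) r := fun r ↦ by
    change cF (algebraMap R (κ.layer (n + 1)) r) = algebraMap R (κ.layer (n + 1)) r
    rw [IsScalarTower.algebraMap_apply R (κ.layer n) (κ.layer (n + 1)), hcF_incl]
    exact congrArg _ (hRfix r)
  exact ⟨R, inferInstance, nonempty_mulEquiv_dihedralGroup_gal hcard hgR hcR hgp hg1 hcFcF hgcg hx₀,
    hdeg2⟩

end ZpExtension

/-! ### Step (4) from Prop. 4.17 for a general dihedral extension -/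

/-- **The dihedral congruence along the anticyclotomic tower, from Prop. 4.17 at its printed
generality** (Dokchitser–Dokchitser 2010, §4.6, proof of Thm. 4.19, pp. 26–27). Hypothesis `h417D`:
Prop. 4.17 of the source (p. 25: "Suppose `Gal(F/K) = D_{2p}` with `p` an odd prime, and pick
extensions `M/K` and `L/K` in `F` of degree 2 and `p`, respectively. For every principally polarised
abelian variety `A/K`, `rk_p(A/M) + 2/(p-1) (rk_p(A/L) - rk_p(A/K)) ≡ ord_p C(A/F)/C(A/M) (mod 2)`")
for elliptic curves `A = E/K` over an arbitrary number field `K` (here `R`), an arbitrary Galois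
extension `F/K` with `Gal(F/K) ≅ D_{2p}` and its quadratic subextension `M` (a `K`-algebra of degree
`2` mapping to `F`), in the form in which it is invoked on p. 27 — "`rk_p(E/M) + m_ρ ≡ ord_p
C(E/F)/C(E/M) (mod 2)`" — with `m_ρ`, the multiplicity of `ρ` in `X_p(E/F)`, characterised through
"`rk_p(E/M) = m_1 + m_ε`" (Lemma 4.14) and `rk_p(E/F) = dim X` by
`rk_p(E/F) = rk_p(E/M) + (p - 1) m_ρ`; `C(E/·) = modifiedTamagawaProduct` of the base changes (the
same `K`-rational differential throughout, as the authors prescribe), `rk_p = selmerCorank`.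
Conclusion: for `E/ℚ`, `p` odd, `M₀` imaginary quadratic with the Heegner hypothesis for `N_E` and
`κ` anticyclotomic, every `n` admits `m_ρ` with `rk_p(E/M_{n+1}) = rk_p(E/M_n) + (p-1) m_ρ` and
`rk_p(E/M_n) + m_ρ` even — the hypothesis `h417` of
`dokchitser_selmerCorank_baseChange_mod_two_eq_of_h417_of_hCV`. Proof, as printed: `m_ρ` exists
(`exists_selmerCorank_baseChange_eq_add_of_prime_degree` for the degree-`p` Galois extension
`M_{n+1}/M_n`); replace `E` by a global minimal model (`exists_baseChange_int_forall_isMinimalAt`,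
`IsIsogenous.selmerCorank_eq`, `conductorNorm_smul_rat`); apply `h417D` to the real subfield `K_n = M_n^{c}`
(`c = layerInvolution`, `[M_n : K_n] = 2`), over which `M_{n+1}` is Galois (`M_{n+1}/ℚ` is,
`ZpExtension.isGalois_rat_layer`) with group `D_{2p}` (`ZpExtension.exists_rotation_layer_succ`,
`nonempty_mulEquiv_dihedralGroup`); "Since all bad primes of `E` split in `M/K`, …
both `C(E/F)` and `C(E/M)` are squares" (`ZpExtension.isSquare_modifiedTamagawaProduct_baseChange_rat_layer`),
"So the right-hand side in the above formula is zero" (`even_of_natCast_modEq_padicValRat_mul_self_div`).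
[cite: DokchitserDokchitserAnnals2010, Prop. 4.17 (p. 25) and §4.6, proof of Thm. 4.19 (pp. 26–27)] -/
theorem exists_even_selmerCorank_layer_of_prop417_dihedral
    (h417D : ∀ (p : ℕ) [Fact p.Prime], p ≠ 2 →
      ∀ (R : Type) [Field R] [NumberField R] (F : Type) [Field F] [NumberField F] [Algebra R F]
        [IsGalois R F], Nonempty ((F ≃ₐ[R] F) ≃* DihedralGroup p) →
        ∀ (M : Type) [Field M] [NumberField M] [Algebra R M] [Algebra M F] [IsScalarTower R M F],
          Module.finrank R M = 2 →
          ∀ (E : WeierstrassCurve R) [E.IsElliptic] (mρ : ℕ),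
            (E.baseChange F).selmerCorank p = (E.baseChange M).selmerCorank p + (p - 1) * mρ →
              (((E.baseChange M).selmerCorank p + mρ : ℕ) : ℤ) ≡
                padicValRat p ((E.baseChange F).modifiedTamagawaProduct /
                  (E.baseChange M).modifiedTamagawaProduct) [ZMOD 2]) :
    ∀ (W : WeierstrassCurve ℚ) [W.IsElliptic] (p : ℕ) [Fact p.Prime], p ≠ 2 →
      ∀ (K : Type) [Field K] [NumberField K], IsImaginaryQuadratic K →
        SatisfiesHeegnerHypothesis (W.conductorNorm ℤ) K →
          ∀ (κ : ZpExtension K p), κ.IsAnticyclotomic → ∀ n : ℕ, ∃ mρ : ℕ,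
            (W.baseChange (κ.layer (n + 1))).selmerCorank p =
                (W.baseChange (κ.layer n)).selmerCorank p + (p - 1) * mρ ∧
              Even ((W.baseChange (κ.layer n)).selmerCorank p + mρ) := by
  intro W _ p _ hp K _ _ hK hH κ hκ n
  have hprime : p.Prime := Fact.out
  haveI : IsTotallyComplex K := hK.2
  -- a global minimal model `W' = W₀ ⊗ ℚ = C • W` over `ℤ`
  obtain ⟨C, W₀, hCW, hmin⟩ := exists_baseChange_int_forall_isMinimalAt W
  haveI hW' : (W₀.baseChange ℚ).IsElliptic := by rw [← hCW]; infer_instance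
  have hΔ0 : W₀.Δ ≠ 0 := by
    intro h0
    apply (W₀.baseChange ℚ).isUnit_Δ.ne_zero
    rw [WeierstrassCurve.baseChange, map_Δ, h0, map_zero]
  have hN : (W₀.baseChange ℚ).conductorNorm ℤ = W.conductorNorm ℤ := by
    rw [← hCW]; exact conductorNorm_smul_rat W C
  have hH' : SatisfiesHeegnerHypothesis ((W₀.baseChange ℚ).conductorNorm ℤ) K := by rwa [hN]
  have hsel : ∀ m : ℕ, (W.baseChange (κ.layer m)).selmerCorank p =
      ((W₀.baseChange ℚ).baseChange (κ.layer m)).selmerCorank p := fun m ↦ by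
    have e : (W₀.baseChange ℚ).baseChange (κ.layer m) =
        C.map (algebraMap ℚ (κ.layer m)) • W.baseChange (κ.layer m) := by
      rw [← hCW, WeierstrassCurve.baseChange, WeierstrassCurve.baseChange, map_variableChange]
    rw [e]
    exact (isIsogenous_smul (W.baseChange (κ.layer m)) (C.map (algebraMap ℚ (κ.layer m)))).selmerCorank_eq p
  -- the layers `M = M_n ⊆ F = M_{n+1}`: Galois of degree `p`
  letI : Algebra (κ.layer n) (κ.layer (n + 1)) :=
    (IntermediateField.inclusion (κ.layer_mono n.le_succ)).toRingHom.toAlgebra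
  haveI : IsGalois (κ.layer n) (κ.layer (n + 1)) := by
    haveI : IsScalarTower K (κ.layer n) (κ.layer (n + 1)) :=
      IsScalarTower.of_algebraMap_eq fun _ ↦ rfl
    exact IsGalois.tower_top_of_isGalois K _ _
  haveI : Module.Free (κ.layer n) (κ.layer (n + 1)) := Module.Free.of_divisionRing _ _
  have hdeg : Module.finrank (κ.layer n) (κ.layer (n + 1)) = p := by
    haveI : IsScalarTower K (κ.layer n) (κ.layer (n + 1)) :=
      IsScalarTower.of_algebraMap_eq fun _ ↦ rfl
    have h := Module.finrank_mul_finrank K (κ.layer n) (κ.layer (n + 1))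
    rw [κ.finrank_layer_holds n, κ.finrank_layer_holds (n + 1), pow_succ] at h
    exact Nat.eq_of_mul_eq_mul_left (pow_pos hprime.pos n) h
  have hincl : ∀ y : κ.layer n, ((algebraMap (κ.layer n) (κ.layer (n + 1)) y : κ.layer (n + 1)) :
      AlgebraicClosure K) = (y : AlgebraicClosure K) := fun y ↦ by
    rw [show algebraMap (κ.layer n) (κ.layer (n + 1)) y =
      IntermediateField.inclusion (κ.layer_mono n.le_succ) y from rfl]
    exact IntermediateField.coe_inclusion _ y
  -- `m_ρ`
  obtain ⟨mρ, hmρ⟩ := exists_selmerCorank_baseChange_eq_add_of_prime_degree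
    ((W₀.baseChange ℚ).baseChange (κ.layer n)) (κ.layer (n + 1)) p hp hdeg
  rw [baseChange_baseChange_of_rat] at hmρ
  -- the real subfield `K_n ⊆ M_n` with `Gal(M_{n+1}/K_n) ≅ D_{2p}`
  obtain ⟨R, hRgal, hiso, hdeg2⟩ := ZpExtension.exists_realSubfield_dihedral hK hκ n hincl
  letI instRF : Algebra R (κ.layer (n + 1)) := inferInstance
  letI instModRF : Module R (κ.layer (n + 1)) := Algebra.toModule
  letI instModRM : Module R (κ.layer n) := Algebra.toModule
  haveI instTow : IsScalarTower R (κ.layer n) (κ.layer (n + 1)) := inferInstance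
  haveI := hRgal
  haveI : NumberField R := numberField_intermediateField R
  -- Prop. 4.17 over `K_n`
  have h := h417D p hp R (κ.layer (n + 1)) hiso (κ.layer n) hdeg2
    ((W₀.baseChange ℚ).baseChange R) mρ
  rw [baseChange_baseChange_of_rat, baseChange_baseChange_of_rat] at h
  have hcong := h hmρ
  -- "both `C(E/F)` and `C(E/M)` are squares … so the right-hand side is zero"
  obtain ⟨r, hr⟩ :=
    ZpExtension.isSquare_modifiedTamagawaProduct_baseChange_rat_layer W₀ hΔ0 hmin hK hH' hκ (n + 1)
  obtain ⟨s, hs⟩ :=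
    ZpExtension.isSquare_modifiedTamagawaProduct_baseChange_rat_layer W₀ hΔ0 hmin hK hH' hκ n
  rw [hr, hs] at hcong
  refine ⟨mρ, ?_, ?_⟩
  · rw [hsel (n + 1), hsel n]
    exact hmρ
  · rw [hsel n]
    exact even_of_natCast_modEq_padicValRat_mul_self_div p hcong

/-- **The named fact `dokchitser_selmerCorank_baseChange_mod_two_eq` from Prop. 4.17 for a general
dihedral extension and the Cornut–Vatsal / Nekovář input** (Dokchitser–Dokchitser 2010, §4.6,
step (4) of the proof of Thm. 4.19 = Thm. 1.4: `rk_p(E/M₀)` is odd). Hypotheses: `h417D` —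
Prop. 4.17 of the source for elliptic curves over an arbitrary number field and an arbitrary
`D_{2p}`-extension, in the form invoked on p. 27 (see
`exists_even_selmerCorank_layer_of_prop417_dihedral`); `hCV` — "Now take `n` large enough. Then
Cornut–Vatsal's Thm. 1.5 [with Yuan–Zhang–Zhang and Tian–Zhang, or Cornut–Vatsal Thm. 4.2 with
Nekovář Thm. 3.2] … so `m_ρ = pⁿ`", i.e. `rk_p(E/M_{n+1}) = rk_p(E/M_n) + (p-1) pⁿ` for all large
`n`. Everything else of the printed proof is a theorem of the tree: the anticyclotomic
`ℤ_p`-extension (`ZpExtension.exists_isAnticyclotomic_holds`), Cor. 4.15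
(`forall_selmerCorank_baseChange_mod_two_eq_of_prime_degree`), Lemma 4.14 and the existence of
`m_ρ` (`exists_selmerCorank_baseChange_eq_add_of_prime_degree`), the dihedral structure
`Gal(M_{n+1}/K_n) ≅ D_{2p}` (`ZpExtension.isGalois_rat_layer`, `ZpExtension.exists_rotation_layer_succ`,
`nonempty_mulEquiv_dihedralGroup`) and the squares remark
(`ZpExtension.isSquare_modifiedTamagawaProduct_baseChange_rat_layer`); the assembly is
`dokchitser_selmerCorank_baseChange_mod_two_eq_of_h417_of_hCV`. What remains hypothetical: Prop. 4.17
itself (§§4.1–4.3: Thm. 4.3, Cor. 4.5, Thm. 4.11 for products of Weil restrictions) and the CM-point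
theorem of Cornut–Vatsal with Tian–Zhang / Nekovář.
[cite: DokchitserDokchitserAnnals2010, §4.6, proof of Thm. 4.19 (= Thm. 1.4), pp. 26–27, with Prop. 4.17 (p. 25)]
[cite: CornutVatsal2007, Thm. 1.5 and Thm. 4.2] [cite: Nekovar2007, Thm. 3.2] -/
theorem dokchitser_selmerCorank_baseChange_mod_two_eq_of_prop417_dihedral_of_hCV
    (h417D : ∀ (p : ℕ) [Fact p.Prime], p ≠ 2 →
      ∀ (R : Type) [Field R] [NumberField R] (F : Type) [Field F] [NumberField F] [Algebra R F]
        [IsGalois R F], Nonempty ((F ≃ₐ[R] F) ≃* DihedralGroup p) →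
        ∀ (M : Type) [Field M] [NumberField M] [Algebra R M] [Algebra M F] [IsScalarTower R M F],
          Module.finrank R M = 2 →
          ∀ (E : WeierstrassCurve R) [E.IsElliptic] (mρ : ℕ),
            (E.baseChange F).selmerCorank p = (E.baseChange M).selmerCorank p + (p - 1) * mρ →
              (((E.baseChange M).selmerCorank p + mρ : ℕ) : ℤ) ≡
                padicValRat p ((E.baseChange F).modifiedTamagawaProduct /
                  (E.baseChange M).modifiedTamagawaProduct) [ZMOD 2])
    (hCV : ∀ (W : WeierstrassCurve ℚ) [W.IsElliptic] (p : ℕ) [Fact p.Prime], p ≠ 2 →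
      ∀ (K : Type) [Field K] [NumberField K], IsImaginaryQuadratic K →
        SatisfiesHeegnerHypothesis (W.conductorNorm ℤ) K →
          ∀ (κ : ZpExtension K p), κ.IsAnticyclotomic → ∃ n₀ : ℕ, ∀ n ≥ n₀,
            (W.baseChange (κ.layer (n + 1))).selmerCorank p =
              (W.baseChange (κ.layer n)).selmerCorank p + (p - 1) * p ^ n) :
    dokchitser_selmerCorank_baseChange_mod_two_eq :=
  dokchitser_selmerCorank_baseChange_mod_two_eq_of_h417_of_hCV
    (fun W _ p _ hp K _ _ hK hH κ hκ n ↦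
      exists_even_selmerCorank_layer_of_prop417_dihedral h417D W p hp K hK hH κ hκ n)
    hCV

end Literature.NumberTheory.EllipticCurves
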